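import Summits.Ventures.HodgeRepro2.T5Unitarization
import Summits.Ventures.HodgeRepro2.T5MultiplicityGeneral

/-!
# Character theory of compact groups, finite-dimensional continuous representations, no unitarity

Blind cell `pub-hodge-repro2`, seat p1 (gen 12), Tier-5 kernel support for the representation-theoretic
sentences of `route/T5-SUPPORT-p1.md` §S4.7 («each once» read off from characters).

With `T5Unitarization` the Schur relations hold for every continuous finite-dimensional representation
of a compact group.  This file records the classical consequences in the form used when K-types are
«read off from characters»:

* `integrable_character_mul_conj` — `χ_π · conj χ_σ` is integrable (continuous on a compact group);
* `integral_character_mul_conj_eq_ite` — **orthonormality of irreducible characters**: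
  `∫ χ_π · conj χ_σ dμ = 1` if `π ≃ σ`, `= 0` otherwise, for arbitrary continuous irreducible `π`, `σ`;
* `linearIndependent_character` — **the characters of pairwise inequivalent irreducible continuous
  representations are linearly independent** (integrate a vanishing combination against each
  conjugate character);
* `exists_decomposition_integral_character_eq_card` — **the character multiplicity formula with no
  unitarity anywhere**: `∫ χ_π · conj χ_σ dμ = #{summands of S equivalent to σ}` for every continuous
  irreducible `σ` (the `σ` of `T5MultiplicityGeneral` is replaced by its unitarized synonym, which has
  the same character and the same `toRep`).

Print: Goodman–Wallach GTM 255 §7.3.4 p. 360 (the compact-group Schur relations) and §4.3.2 (the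
finite-group orthogonality of characters, Lemma 4.3.3 p. 208); held copy text pages p0305 / p0458.
Honest scope (unchanged): compact groups and finite-dimensional representations only; nothing about
U(1,1), π₃⁺ or (N).
-/

namespace Summit.Ventures.HodgeRepro2.T5CharacterTheory

open MeasureTheory T5SchurOrthogonality T5SchurMathlib T5Unitarization

variable {G : Type*} [Group G] [TopologicalSpace G] [IsTopologicalGroup G]
  [MeasurableSpace G] [BorelSpace G] [CompactSpace G]
variable (μ : Measure G) [IsProbabilityMeasure μ] [μ.IsOpenPosMeasure] [μ.IsMulLeftInvariant]

section integrable

variable {V : Type*} [NormedAddCommGroup V] [InnerProductSpace ℂ V] [FiniteDimensional ℂ V]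
variable {W : Type*} [NormedAddCommGroup W] [InnerProductSpace ℂ W] [FiniteDimensional ℂ W]

omit [IsTopologicalGroup G] [μ.IsOpenPosMeasure] [μ.IsMulLeftInvariant] in
/-- `χ_π · conj χ_σ` is continuous, hence integrable on the compact group `G` (finite measure). -/
theorem integrable_character_mul_conj (π : G →* V →L[ℂ] V) (σ : G →* W →L[ℂ] W)
    (hπ : Continuous π) (hσ : Continuous σ) :
    Integrable (fun g => character π g * (starRingEnd ℂ) (character σ g)) μ :=
  ((T5Multiplicity.continuous_character π hπ).mul
    (Complex.continuous_conj.comp (T5Multiplicity.continuous_character σ hσ))).integrable_of_hasCompactSupport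
    (HasCompactSupport.of_compactSpace _)

open Classical in
/-- **Orthonormality of irreducible characters** (no unitarity): for continuous irreducible `π`, `σ`,
`∫ χ_π · conj χ_σ dμ` is `1` if `σ ≃ π` and `0` otherwise. -/
theorem integral_character_mul_conj_eq_ite [Nontrivial V] [Nontrivial W]
    (π : G →* V →L[ℂ] V) (σ : G →* W →L[ℂ] W) (hπ : Continuous π) (hσ : Continuous σ)
    (hπi : IsIrreducible π) (hσi : IsIrreducible σ) :
    ∫ g, character π g * (starRingEnd ℂ) (character σ g) ∂μ =
      if Nonempty ((toRep σ).Equiv (toRep π)) then 1 else 0 := by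
  classical
  split_ifs with h
  · obtain ⟨e⟩ := h
    have hchar : ∀ g, character π g = character σ g := T5Multiplicity.character_eq_of_equiv σ π e
    simp_rw [hchar]
    exact integral_character_mul_conj_of_isIrreducible μ σ hσ hσi
  · haveI : (toRep π).IsIrreducible := (isIrreducible_iff π).mp hπi
    haveI : (toRep σ).IsIrreducible := (isIrreducible_iff σ).mp hσi
    haveI : IsEmpty ((toRep σ).Equiv (toRep π)) := not_nonempty_iff.mp h
    exact integral_character_mul_conj_eq_zero μ π hπ σ hσ

end integrable

section independent

variable {ι : Type*} {W : ι → Type*} [∀ i, NormedAddCommGroup (W i)]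
  [∀ i, InnerProductSpace ℂ (W i)] [∀ i, FiniteDimensional ℂ (W i)] [∀ i, Nontrivial (W i)]

include μ in
/-- **Linear independence of irreducible characters**: the characters of a family of pairwise
inequivalent continuous irreducible representations of a compact group are linearly independent as
functions `G → ℂ` (a vanishing combination integrated against `conj χ_j` leaves the `j`-th
coefficient, by orthonormality). -/
theorem linearIndependent_character (σ : ∀ i, G →* (W i →L[ℂ] W i)) (hc : ∀ i, Continuous (σ i))
    (hirr : ∀ i, IsIrreducible (σ i))
    (hne : ∀ i j, i ≠ j → IsEmpty ((toRep (σ i)).Equiv (toRep (σ j)))) :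
    LinearIndependent ℂ (fun i => character (σ i)) := by
  classical
  rw [linearIndependent_iff']
  intro s c hsum j hj
  have hfun : ∀ g, ∑ i ∈ s, c i * character (σ i) g = 0 := fun g => by
    have := congrFun hsum g
    simpa [Finset.sum_apply, Pi.smul_apply, smul_eq_mul] using this
  -- the term-wise integrals
  have hterm : ∀ i ∈ s,
      ∫ g, c i * (character (σ i) g * (starRingEnd ℂ) (character (σ j) g)) ∂μ =
        if i = j then c i else 0 := by
    intro i _
    rw [integral_const_mul, integral_character_mul_conj_eq_ite μ (σ i) (σ j) (hc i) (hc j)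
      (hirr i) (hirr j)]
    by_cases hij : i = j
    · subst hij
      simp [Nonempty.intro (Representation.Equiv.refl (toRep (σ i)))]
    · have : ¬ Nonempty ((toRep (σ j)).Equiv (toRep (σ i))) :=
        not_nonempty_iff.mpr (hne j i (Ne.symm hij))
      simp [hij, this]
  have key : ∫ g, (∑ i ∈ s, c i * character (σ i) g) * (starRingEnd ℂ) (character (σ j) g) ∂μ
      = c j := by
    simp_rw [Finset.sum_mul, mul_assoc]
    rw [integral_finsetSum _ fun i _ =>
      (integrable_character_mul_conj μ (σ i) (σ j) (hc i) (hc j)).const_mul (c i)]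
    rw [Finset.sum_congr rfl hterm, Finset.sum_ite_eq' s j]
    simp [hj]
  have hzero : (fun g => (∑ i ∈ s, c i * character (σ i) g) * (starRingEnd ℂ) (character (σ j) g))
      = fun _ => 0 := funext fun g => by rw [hfun g, zero_mul]
  rw [hzero] at key
  simpa using key.symm

end independent

section multiplicity

variable {V : Type*} [NormedAddCommGroup V] [InnerProductSpace ℂ V] [FiniteDimensional ℂ V]

/-- **The character multiplicity formula, no unitarity anywhere**: every continuous finite-dimensional
`π` of a compact group has an irreducible internal-direct-sum decomposition `S` for which, for every
continuous irreducible `σ` (not assumed unitary), `∫ χ_π · conj χ_σ dμ` is the number of summands of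
`S` on which `π` restricts to a representation equivalent to `σ`
(`T5MultiplicityGeneral.equivCount`). -/
theorem exists_decomposition_integral_character_eq_card (π : G →* V →L[ℂ] V) (hπ : Continuous π) :
    ∃ S : Finset (Submodule ℂ V), (∀ W ∈ S, T5CompleteReducibility.IsIrreducibleSubspace π W) ∧
      DirectSum.IsInternal (fun W : S => (W : Submodule ℂ V)) ∧
      ∃ hst : ∀ W ∈ S, T5CompleteReducibility.IsStable π W,
        ∀ {W₀ : Type} [NormedAddCommGroup W₀] [InnerProductSpace ℂ W₀] [FiniteDimensional ℂ W₀]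
          (σ : G →* W₀ →L[ℂ] W₀), Continuous σ → ∀ [(toRep σ).IsIrreducible],
          ∫ g, character π g * (starRingEnd ℂ) (character σ g) ∂μ =
            (T5MultiplicityGeneral.equivCount π σ S hst : ℂ) := by
  obtain ⟨S, hS, hint, hst, h⟩ :=
    T5MultiplicityGeneral.exists_decomposition_integral_character_eq_card π μ hπ
  refine ⟨S, hS, hint, hst, ?_⟩
  intro W₀ _ _ _ σ hσ _
  haveI : (toRep (unitarizedRep μ σ hσ)).IsIrreducible := ‹(toRep σ).IsIrreducible›
  exact h (unitarizedRep μ σ hσ) (continuous_unitarizedRep μ σ hσ) (isUnitary_unitarizedRep μ σ hσ)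

end multiplicity

end Summit.Ventures.HodgeRepro2.T5CharacterTheory
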